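import Literature.Computability.AlgebraicComplexity.MS21InertHomogenization
import Literature.Computability.AlgebraicComplexity.MS21SparseOrbitHittingProofs
import Mathlib.LinearAlgebra.Matrix.SchurComplement
import Mathlib.Algebra.MvPolynomial.PDeriv
import HarnessLib

/-!
# Medini–Shpilka 2021, §5.2 / B34 repair step 3: derivatives and Lemma-3.10 kills commute with
# homogenisation; the bordered shape `Ã = [[A, b],[0, 1]]` is preserved by kills

Theorem-only support file (cell `val-lit`, seat p1 g5) continuing `MS21InertHomogenization.lean`
(step 1: `f ∘ G ≠ 0 ↔ g_d(f) ∘ G⁺ ≠ 0`, `G⁺ = (G, u^e)` inert) and `MS21PointwiseIndependence.lean`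
(step 2: peeling blocks of `G⁺` at `castSucc` coordinates) of the PRINT-ERRATA B34 repair for
`MS2021_thm_35` (cell memo `np/p1g5-B34-repair-memo.md`, ADDENDUM 02:45Z): the homogeneous
h-world `h = g_d(f)` is used only for the monomial combinatorics of §5.2, and every operation the
printed proof performs there — directional derivatives (Lemma 3.8) and kills (Lemma 3.10) — is the
homogenisation of the same operation on the affine `f`, so every hitting statement transfers back
to the affine world where the printed/landed engines (Thm 33, Lemma 5.15) apply unchanged:

* `MS2021.pderiv_homogeneousComponent_succ/_zero`, `MS2021.pderiv_castSucc_homogenization`,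
  `MS2021.dirDeriv_castSucc_homogenization`: `∂_{(v,0)} g_{d+1}(f) = g_d(∂_v f)` for directions on
  the original variables — and the Lemma-3.8 dual directions for a bordered matrix ARE such
  (column `castSucc i` of `Ã⁻¹ = [[A⁻¹, -A⁻¹b],[0,1]]`); packaged as
  `MS2021.bind₁_dirDeriv_ne_zero_iff_inert`.
* `MS2021.homogenization_shift_eq`: `g_d(f(x + L(x)e_i)) = g_d(f)(x̃ + L̃(x̃)e_{castSucc i})` for an
  affine `L = ℓ(x) + c` and its homogenisation `L̃ = ℓ(x) + c x_n`.
* the explicit affine Lemma-3.10 shear (`MS2021.aeval_shift_affineForm`, `MS2021.isUnit_det_shear_mul`,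
  `MS2021.affSubst_shear_restrictZero_eq`: `f(x + L(x)e_j) = g|_{y_r=0}(A''x + b'')` with the
  EXPLICIT `L = -(ℓ_{i*} + b_{i*})/β` and `A'' = (1 + u e_{i*}ᵀ)A`, `det = det A` by the matrix
  determinant lemma) — the toolkit's `exists_shift_affSubst_eq` hides `L`, whose affine shape the
  transfer needs;
* `MS2021.exists_castSucc_shift_borderMatrix` (B34 brick S3b): in the h-world the kill happens at a
  coordinate `castSucc j` (never the inert one), with a LINEAR `L̃`, and lands again on a bordered
  matrix: `g(Ãx̃)(x̃ + L̃ e_{castSucc j}) = g|_{y_r=0}(Ã'x̃)`, `Ã' = borderMatrix A' b' ∈ GL_{n+1}`.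

No definitions, no facts. HONEST FRAMING: plumbing for a literature discharge / erratum record;
`VP ≠ VNP` is NOT proved and nothing here bears on it.

## References
* [MediniShpilka2021] D. Medini, A. Shpilka, CCC 2021 (LIPIcs 200:19) = arXiv:2102.05632: Def 3.6–3.7,
  Lemma 3.8 (p0017:L44-L66), Lemma 3.10 (p0018:L14-L34), §5.2 lem:uniIndGenHitsHom (p0027:L22-L30),
  proofs of Thm 35 (p0030:L28-L33) and Thm 45 (p0036:L9-L10).
-/

noncomputable section

open MvPolynomial Matrix

namespace Literature.Computability.AlgebraicComplexity

namespace MS2021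

/-! ### Partial derivatives commute with homogeneous components and with homogenisation -/

section Derivatives

variable {K : Type*} [Field K] {σ : Type*}

/-- `∂_j (f^{[i+1]}) = (∂_j f)^{[i]}` (formal partial derivatives lower the homogeneous degree by one;
Def 3.6 "formal derivative"). [cite: MediniShpilka2021, Def 3.6 (arXiv p0017:L46-L50)] -/
theorem pderiv_homogeneousComponent_succ (j : σ) (i : ℕ) (f : MvPolynomial σ K) :
    pderiv j (homogeneousComponent (i + 1) f) = homogeneousComponent i (pderiv j f) := by
  classical
  ext m
  rw [coeff_pderiv, coeff_homogeneousComponent, coeff_homogeneousComponent, coeff_pderiv]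
  have hdeg : (m + Finsupp.single j 1).degree = m.degree + 1 := by
    rw [map_add, Finsupp.degree_single]
  rw [hdeg]
  simp only [add_left_inj]
  split_ifs <;> simp

/-- `∂_j (f^{[0]}) = 0` (the constant term). [cite: MediniShpilka2021, Def 3.6 (arXiv p0017:L46-L50)] -/
theorem pderiv_homogeneousComponent_zero (j : σ) (f : MvPolynomial σ K) :
    pderiv j (homogeneousComponent 0 f) = 0 := by
  rw [homogeneousComponent_zero, pderiv_C]

variable {n : ℕ}

/-- **Derivatives along the original variables commute with homogenisation**:
`∂_{castSucc j} g_{d+1}(f) = g_d(∂_j f)` (the homogenising variable `x_n` is a constant for `∂_j`).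
[cite: MediniShpilka2021, Def 3.6 and lem:uniIndGenHitsHom (arXiv p0017:L46-L50, p0027:L22-L24)] -/
theorem pderiv_castSucc_homogenization (j : Fin n) (d : ℕ) (f : MvPolynomial (Fin n) K) :
    pderiv (Fin.castSucc j) (∑ i ∈ Finset.range (d + 1 + 1), X (Fin.last n) ^ (d + 1 - i) *
        rename Fin.castSucc (homogeneousComponent i f)) =
      ∑ i ∈ Finset.range (d + 1), X (Fin.last n) ^ (d - i) *
        rename Fin.castSucc (homogeneousComponent i (pderiv j f)) := by
  classical
  rw [map_sum, Finset.sum_range_succ']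
  have hX : ∀ k : ℕ, pderiv (Fin.castSucc j) (X (Fin.last n) ^ k : MvPolynomial (Fin (n + 1)) K) = 0 := by
    intro k
    rw [pderiv_pow, pderiv_X_of_ne (Fin.castSucc_lt_last j).ne', mul_zero]
  have hterm : ∀ i, pderiv (Fin.castSucc j) (X (Fin.last n) ^ (d + 1 - i) *
      rename Fin.castSucc (homogeneousComponent i f)) =
      X (Fin.last n) ^ (d + 1 - i) * rename Fin.castSucc (pderiv j (homogeneousComponent i f)) := by
    intro i
    rw [Derivation.leibniz, hX, smul_zero, add_zero, pderiv_rename (Fin.castSucc_injective _),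
      smul_eq_mul]
  simp_rw [hterm, pderiv_homogeneousComponent_succ, pderiv_homogeneousComponent_zero, map_zero,
    mul_zero, add_zero]
  refine Finset.sum_congr rfl fun i hi => ?_
  have := Finset.mem_range.1 hi
  congr 2
  omega

/-- Directional form: `∂_{(v,0)} g_{d+1}(f) = g_d(∂_v f)` for every direction `v` supported on the
original variables. [cite: MediniShpilka2021, Def 3.6, Lemma 3.8 (arXiv p0017:L46-L66)] -/
theorem dirDeriv_castSucc_homogenization (v : Fin n → K) (d : ℕ) (f : MvPolynomial (Fin n) K) :
    (∑ j, C (v j) * pderiv (Fin.castSucc j) (∑ i ∈ Finset.range (d + 1 + 1),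
        X (Fin.last n) ^ (d + 1 - i) * rename Fin.castSucc (homogeneousComponent i f))) =
      ∑ i ∈ Finset.range (d + 1), X (Fin.last n) ^ (d - i) *
        rename Fin.castSucc (homogeneousComponent i (∑ j, C (v j) * pderiv j f)) := by
  simp_rw [pderiv_castSucc_homogenization]
  simp only [map_sum, homogeneousComponent_C_mul, map_mul, rename_C, Finset.mul_sum]
  rw [Finset.sum_comm]
  refine Finset.sum_congr rfl fun i _ => Finset.sum_congr rfl fun j _ => ?_
  ring

end Derivatives

/-! ### Affine shifts `x ↦ x + L(x)·e_i` commute with homogenisation (the Lemma-3.10 kills) -/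

section Shifts

variable {K : Type*} [Field K] {n : ℕ}

/-- The degree of `f(x + L(x) e_i)` for an affine `L` does not exceed that of `f`. [folklore] -/
private theorem totalDegree_shift_le (f : MvPolynomial (Fin n) K) (i : Fin n) (ℓ : Fin n → K) (c : K) :
    (bind₁ (fun j : Fin n => X j + if j = i then ((∑ j', C (ℓ j') * X j') + C c) else 0) f).totalDegree ≤
      f.totalDegree := by
  rw [← aeval_eq_bind₁]
  have key := Literature.RingTheory.Nullstellensatz.totalDegree_aeval_le
    (fun j : Fin n => X j + if j = i then ((∑ j', C (ℓ j') * X j') + C c) else (0 : MvPolynomial (Fin n) K))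
    (δ := 1) (fun j => ?_) f
  · simpa using key
  · refine (totalDegree_add _ _).trans (max_le ?_ ?_)
    · rw [totalDegree_X]
    · split_ifs
      · exact totalDegree_affineForm_le_one ℓ c
      · rw [totalDegree_zero]; exact Nat.zero_le _

/-- **Homogenisation commutes with affine shifts**: for an affine `L(x) = ℓ(x) + c` and its
homogenisation `L̃(x̃) = ℓ(x) + c·x_n`, `g_d(f(x + L(x)e_i)) = (g_d f)(x̃ + L̃(x̃) e_{castSucc i})`
(`d ≥ deg f`). This is the h-world form of the Lemma-3.10 substitution ("`ℓ̃ = x_0 ℓ(x/x_0)`").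
[cite: MediniShpilka2021, Lemma 3.10 and proof of Thm 45 (arXiv p0018:L22-L28, p0036:L9)] -/
theorem homogenization_shift_eq {d : ℕ} (f : MvPolynomial (Fin n) K) (hf : f.totalDegree ≤ d)
    (i : Fin n) (ℓ : Fin n → K) (c : K) :
    (∑ k ∈ Finset.range (d + 1), X (Fin.last n) ^ (d - k) * rename Fin.castSucc
        (homogeneousComponent k
          (bind₁ (fun j : Fin n => X j + if j = i then ((∑ j', C (ℓ j') * X j') + C c) else 0) f))) =
      bind₁ (fun j : Fin (n + 1) => X j + if j = Fin.castSucc i then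
          ((∑ j', C (ℓ j') * X (Fin.castSucc j')) + C c * X (Fin.last n)) else 0)
        (∑ k ∈ Finset.range (d + 1), X (Fin.last n) ^ (d - k) *
          rename Fin.castSucc (homogeneousComponent k f)) := by
  classical
  refine eq_of_isHomogeneous_of_aeval_lastCases_eq (homogenization_isHomogeneous d _ _ _) ?_ ?_
  · -- the shifted homogenisation is homogeneous of degree `d`
    rw [← aeval_eq_bind₁]
    have key := (homogenization_isHomogeneous d f (Fin.last n) Fin.castSucc).aeval
      (fun j : Fin (n + 1) => X j + if j = Fin.castSucc i then
        ((∑ j', C (ℓ j') * X (Fin.castSucc j')) + C c * X (Fin.last n)) else 0) (n := 1) (fun j => ?_)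
    · rwa [one_mul] at key
    · refine (isHomogeneous_X _ _).add ?_
      split_ifs
      · refine (IsHomogeneous.sum _ _ _ fun j' _ => (isHomogeneous_X _ _).C_mul _).add ?_
        exact (isHomogeneous_X _ _).C_mul _
      · exact isHomogeneous_zero _ _ _
  · -- both dehomogenise to `f(x + L(x) e_i)`
    rw [aeval_homogenization_last_castSucc _ ((totalDegree_shift_le f i ℓ c).trans hf),
      ← aeval_eq_bind₁, ← aeval_eq_bind₁, ← AlgHom.comp_apply, comp_aeval]
    have hfun : (fun j : Fin (n + 1) => aeval (Fin.lastCases (motive := fun _ => MvPolynomial (Fin n) K) 1 X)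
        (X j + if j = Fin.castSucc i then
          ((∑ j', C (ℓ j') * X (Fin.castSucc j')) + C c * X (Fin.last n)) else 0)) =
        fun j => aeval (fun j : Fin n => X j + if j = i then ((∑ j', C (ℓ j') * X j') + C c) else 0)
          (Fin.lastCases (motive := fun _ => MvPolynomial (Fin n) K) 1 X j) := by
      funext j
      refine Fin.lastCases ?_ (fun j => ?_) j
      · rw [Fin.lastCases_last, map_one, map_add, aeval_X, Fin.lastCases_last,
          if_neg (Fin.castSucc_lt_last i).ne', map_zero, add_zero]
      · rw [Fin.lastCases_castSucc, map_add, aeval_X, aeval_X, Fin.lastCases_castSucc]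
        simp only [Fin.castSucc_inj]
        split_ifs
        · simp only [map_add, map_sum, map_mul, aeval_C, aeval_X, algebraMap_eq,
            Fin.lastCases_castSucc, Fin.lastCases_last, mul_one]
        · simp
    rw [hfun, ← comp_aeval, AlgHom.comp_apply, aeval_homogenization_last_castSucc _ hf,
      aeval_eq_bind₁]

end Shifts

/-! ### The explicit Lemma-3.10 shear in the affine world (explicit affine `L`, explicit `A''`) -/

section AffineShear

variable {K : Type*} [Field K] {m n : ℕ}

/-- Substituting `x ↦ x + L(x)·e_j` into an affine form `ℓ(x) + b` gives `ℓ(x) + b + ℓ_j · L(x)`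
("`ℓ_i(x + G(α, L(x))) = ℓ_i(x) - (β_i/β_1)·ℓ_1(x)`").
[cite: MediniShpilka2021, proof of Lemma 3.10 (arXiv p0018:L24-L28)] -/
theorem aeval_shift_affineForm (a : Fin n → K) (b : K) (j : Fin n) (L : MvPolynomial (Fin n) K) :
    aeval (fun j' : Fin n => X j' + if j' = j then L else 0)
        ((∑ j', C (a j') * X j') + C b : MvPolynomial (Fin n) K) =
      ((∑ j', C (a j') * X j') + C b) + C (a j) * L := by
  classical
  simp only [map_add, map_sum, map_mul, aeval_C, aeval_X, algebraMap_eq, mul_add,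
    Finset.sum_add_distrib, mul_ite, mul_zero, Finset.sum_ite_eq', Finset.mem_univ, if_true]
  ring

/-- Entries of the shear `(1 + u e_{i*}ᵀ) A`: row `r` is `A_r + u_r A_{i*}`. [folklore] -/
private theorem shear_mul_apply (u : Fin n → K) (i₀ : Fin n) (A : Matrix (Fin n) (Fin n) K) (r j : Fin n) :
    ((1 + vecMulVec u (Pi.single i₀ (1 : K))) * A) r j = A r j + u r * A i₀ j := by
  classical
  rw [Matrix.add_mul, Matrix.one_mul, Matrix.add_apply, vecMulVec_mul]
  simp only [vecMulVec_apply, Matrix.vecMul, dotProduct, Pi.single_apply, ite_mul, one_mul,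
    zero_mul, Finset.sum_ite_eq', Finset.mem_univ, if_true]

/-- The shear `(1 + u e_{i*}ᵀ) A` with `u_{i*} = 0` has the determinant of `A` (matrix determinant
lemma), so it is invertible when `A` is — "`Ã = E·A`, `det E = 1`".
[cite: MediniShpilka2021, proof of Lemma 3.10 (arXiv p0018:L24-L32)] -/
theorem isUnit_det_shear_mul {u : Fin n → K} {i₀ : Fin n} (hu : u i₀ = 0)
    {A : Matrix (Fin n) (Fin n) K} (hA : IsUnit A.det) :
    IsUnit ((1 + vecMulVec u (Pi.single i₀ (1 : K))) * A).det := by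
  classical
  rw [Matrix.det_mul, vecMulVec_eq (ι := Unit), Matrix.det_one_add_replicateCol_mul_replicateRow]
  simp only [dotProduct, Pi.single_apply, ite_mul, one_mul, zero_mul, Finset.sum_ite_eq',
    Finset.mem_univ, if_true, hu, add_zero, one_mul]
  exact hA

/-- Row `r ≠ i*` of the sheared substitution is `ℓ_r + b_r + u_r (ℓ_{i*} + b_{i*})`. [folklore] -/
private theorem affineForm_shear (a a₀ : Fin n → K) (b b₀ w : K) :
    ((∑ j', C (a j' + w * a₀ j') * X j') + C (b + w * b₀) : MvPolynomial (Fin n) K) =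
      ((∑ j', C (a j') * X j') + C b) + C w * ((∑ j', C (a₀ j') * X j') + C b₀) := by
  simp only [map_add, map_mul, add_mul, Finset.sum_add_distrib, mul_add, Finset.mul_sum, mul_assoc]
  abel

/-- **Lemma 3.10 (`k = 1`) in orbit form**: with `β = A_{i* j} ≠ 0`, `L(x) = -(ℓ_{i*}(x) + b_{i*})/β`
and the shear `u_r = -A_{rj}/β` (`r ≠ i*`), `u_{i*} = 0`:
`f(x + L(x)·e_j) = g̃(A'' x + b'')` where `g̃ = g|_{y_i = 0}`, `A'' = (1 + u e_{i*}ᵀ) A`,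
`b'' = b + b_{i*} u` ("there exist linearly independent linear functions `ℓ̃_i` … such that
`f(x + G(α, L(x))) = g̃(ℓ̃_i(x) : i ∈ [m] ∖ S)`").
[cite: MediniShpilka2021, Lemma 3.10 and its proof (arXiv p0018:L16-L34)] -/
theorem affSubst_shear_restrictZero_eq (h : m ≤ n) (A : Matrix (Fin n) (Fin n) K) (b : Fin n → K)
    (g : MvPolynomial (Fin m) K) (i : Fin m) (j : Fin n) (hβ : A (Fin.castLE h i) j ≠ 0)
    (u : Fin n → K) (hu0 : u (Fin.castLE h i) = 0)
    (hu : ∀ r, r ≠ Fin.castLE h i → u r = -(A r j) * (A (Fin.castLE h i) j)⁻¹) :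
    affSubst h ((1 + vecMulVec u (Pi.single (Fin.castLE h i) (1 : K))) * A)
        (fun r => b r + u r * b (Fin.castLE h i))
        (∑ α ∈ g.support with α i = 0, monomial α (coeff α g)) =
      aeval (fun j' : Fin n => X j' + if j' = j then
          C (-(A (Fin.castLE h i) j)⁻¹) * ((∑ j', C (A (Fin.castLE h i) j') * X j') + C (b (Fin.castLE h i)))
        else 0) (affSubst h A b g) := by
  classical
  unfold affSubst
  rw [aeval_restrictZero_eq, ← AlgHom.comp_apply, comp_aeval]
  congr 2
  funext r'
  by_cases hr : r' = i
  · subst hr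
    rw [Function.update_self, aeval_shift_affineForm, ← mul_assoc, ← map_mul, mul_neg,
      mul_inv_cancel₀ hβ, map_neg, map_one, neg_one_mul, add_neg_cancel]
  · have hr' : Fin.castLE h r' ≠ Fin.castLE h i := fun e => hr (Fin.castLE_injective h e)
    rw [Function.update_of_ne hr, aeval_shift_affineForm]
    simp_rw [shear_mul_apply]
    rw [affineForm_shear, hu _ hr', show -A (Fin.castLE h r') j * (A (Fin.castLE h i) j)⁻¹ =
        A (Fin.castLE h r') j * (-(A (Fin.castLE h i) j)⁻¹) by ring, map_mul, mul_assoc]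

end AffineShear

/-! ### The Lemma-3.10 kill in the h-world keeps the matrix bordered (B34 brick S3b) -/

section BorderedKill

variable {K : Type*} [Field K] {m n : ℕ}

/-- The projection `g|_{y_r = 0}` of a homogeneous `g` is homogeneous of the same degree. [folklore] -/
private theorem isHomogeneous_aeval_ite_X {d : ℕ} {g : MvPolynomial (Fin m) K} (hg : g.IsHomogeneous d)
    (r : Fin m) :
    (aeval (fun w : Fin m => if w = r then (0 : MvPolynomial (Fin m) K) else X w) g).IsHomogeneous d := by
  have key := hg.aeval (fun w : Fin m => if w = r then (0 : MvPolynomial (Fin m) K) else X w) (n := 1)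
    (fun w => by
      split_ifs
      · exact isHomogeneous_zero _ _ _
      · exact isHomogeneous_X _ _)
  rwa [one_mul] at key

/-- **Lemma 3.10 in the h-world, explicitly** (B34 brick S3b): for `Ã = [[A, b],[0,1]] ∈ GL_{n+1}`,
`g` homogeneous of degree `d` and a coordinate `r` of `g`, there are a coordinate `j < n` (NOT the
homogenising one), a LINEAR form `L̃ = ℓ(x) + c·x_n` and a bordered `Ã' = [[A', b'],[0,1]] ∈ GL_{n+1}`
with `g(Ãx̃)(x̃ + L̃(x̃)·e_j) = g|_{y_r=0}(Ã'x̃)` — the homogenisation of the printed affine kill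
`f(x + L(x)·e_j) = g̃(A'x + b')`, so kills never touch the inert coordinate and the bordered shape
is preserved. [cite: MediniShpilka2021, Lemma 3.10 (arXiv p0018:L16-L34) and proof of Thm 35 (p0030:L30)] -/
theorem exists_castSucc_shift_borderMatrix {d : ℕ} (h : m ≤ n) {A : Matrix (Fin n) (Fin n) K}
    (hA : IsUnit A.det) (b : Fin n → K) (g : MvPolynomial (Fin m) K) (hg : g.IsHomogeneous d)
    (r : Fin m) :
    ∃ (j : Fin n) (ℓ : Fin n → K) (c : K) (A' : Matrix (Fin n) (Fin n) K) (b' : Fin n → K),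
      A (Fin.castLE h r) j ≠ 0 ∧ IsUnit A'.det ∧
      bind₁ (fun j' : Fin (n + 1) => X j' + if j' = Fin.castSucc j then
          ((∑ j'', C (ℓ j'') * X (Fin.castSucc j'')) + C c * X (Fin.last n)) else 0)
        (affSubst (h.trans (Nat.le_succ n)) (borderMatrix A b) 0 g) =
      affSubst (h.trans (Nat.le_succ n)) (borderMatrix A' b') 0
        (aeval (fun w : Fin m => if w = r then (0 : MvPolynomial (Fin m) K) else X w) g) := by
  classical
  obtain ⟨j, hj⟩ := exists_apply_ne_zero_of_isUnit_det hA (Fin.castLE h r)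
  set β := A (Fin.castLE h r) j with hβ
  set u : Fin n → K := fun r' => if r' = Fin.castLE h r then (0 : K) else -A r' j * β⁻¹ with hu_def
  have hu0 : u (Fin.castLE h r) = 0 := by simp [hu_def]
  have hu : ∀ r', r' ≠ Fin.castLE h r → u r' = -A r' j * (A (Fin.castLE h r) j)⁻¹ :=
    fun r' hr' => by simp [hu_def, hr', hβ]
  refine ⟨j, fun j'' => -β⁻¹ * A (Fin.castLE h r) j'', -β⁻¹ * b (Fin.castLE h r),
    (1 + vecMulVec u (Pi.single (Fin.castLE h r) (1 : K))) * A,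
    fun r' => b r' + u r' * b (Fin.castLE h r), hj, isUnit_det_shear_mul hu0 hA, ?_⟩
  -- the affine identity
  have haff := affSubst_shear_restrictZero_eq h A b g r j hj u hu0 hu
  rw [← aeval_ite_X_eq_restrictZero] at haff
  -- the affine `L` in the form `ℓ·x + c`
  have hL : (C (-(A (Fin.castLE h r) j)⁻¹) * ((∑ j', C (A (Fin.castLE h r) j') * X j') +
      C (b (Fin.castLE h r))) : MvPolynomial (Fin n) K) =
      (∑ j'', C (-β⁻¹ * A (Fin.castLE h r) j'') * X j'') + C (-β⁻¹ * b (Fin.castLE h r)) := by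
    simp only [hβ, map_mul, map_neg, mul_add, Finset.mul_sum, mul_assoc]
  rw [hL] at haff
  -- homogenise both sides
  have hdegf : (affSubst h A b g).totalDegree ≤ d :=
    (totalDegree_affSubst_le h A b g).trans hg.totalDegree_le
  rw [← homogenization_affSubst_eq h A b g hg, ← homogenization_shift_eq _ hdegf, ← aeval_eq_bind₁,
    ← haff, homogenization_affSubst_eq h _ _ _ (isHomogeneous_aeval_ite_X hg r)]

end BorderedKill

/-! ### Packaged: directional derivatives of `f ∘ G` vs of `g_{d+1}(f) ∘ G⁺` -/

section Packaged

variable {K : Type*} [Field K] {n : ℕ} {τ : Type*}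

/-- **Derivative transfer** (B34 brick S3a packaged): for a direction `v` on the original
variables, `(∂_v f) ∘ G ≠ 0 ↔ (∂_{(v,0)} g_{d+1}(f)) ∘ G⁺ ≠ 0`, `G⁺` the inert extension of a map
with all coordinates homogeneous of degree `e ≥ 1` (`d ≥ deg ∂_v f`).
[cite: MediniShpilka2021, Lemma 3.8 and lem:uniIndGenHitsHom (arXiv p0017:L60-L66, p0027:L22-L30)] -/
theorem bind₁_dirDeriv_ne_zero_iff_inert {d e : ℕ} (f : MvPolynomial (Fin n) K) (v : Fin n → K)
    (hf' : (∑ j, C (v j) * pderiv j f).totalDegree ≤ d) (G : Fin n → MvPolynomial τ K) (he : 1 ≤ e)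
    (hG : ∀ j, (G j).IsHomogeneous e) :
    bind₁ G (∑ j, C (v j) * pderiv j f) ≠ 0 ↔
      bind₁ (Fin.lastCases (motive := fun _ => MvPolynomial (τ ⊕ Unit) K)
          (X (Sum.inr ()) ^ e) (fun j => rename Sum.inl (G j)))
        (∑ j, C (v j) * pderiv (Fin.castSucc j) (∑ i ∈ Finset.range (d + 1 + 1),
          X (Fin.last n) ^ (d + 1 - i) * rename Fin.castSucc (homogeneousComponent i f))) ≠ 0 := by
  rw [dirDeriv_castSucc_homogenization]
  exact bind₁_ne_zero_iff_inert_homogenization _ hf' G he hG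

end Packaged

end MS2021

end Literature.Computability.AlgebraicComplexity

end
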